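import Mathlib.RingTheory.PowerSeries.Order
import Mathlib.NumberTheory.Padics.PadicIntegers
import HarnessLib

/-!
# The parity-squeeze kernel at `p = 2` (door (F*), cell `bsd-rank2`)

Cell `bsd-rank2` (D-0036), seat `bsd-rank2-lit` GEN 14, for planner p2 GEN 13's door (F*) «odd-parity
2-adic λ-squeeze» (memo `run/shared/lean/pub/bsd-rank2/p2/PADIC-R2-G13.md` §3; route sketch
`p2/g13/routeF/Sketch.lean`, support item `ParitySqueezeKernel`, flagged there as "pure algebra, provable now").

PARTITION: none — r_an ≥ 2, summit axis S0; TWIN (D-0056): n/a. B1: pure power-series algebra, no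
L-function, no Selmer group, no S0 motion.

## The statement

Let `g ∈ ℤ_p⟦T⟧` be divisible by `T + a` with `a ∈ ℤ_p` a NON-UNIT, `a ≠ 0` (door (F*): `p = 2`, `a = 2`,
the sign-forced zero of `L₂(E,T)` at the order-two character `T = −2`). If the coefficients of `g` in
degrees `< k` vanish, then writing `g = (T + a) h` one gets inductively `coeff_j h = 0` for `j < k`
(`ℤ_p` is a domain and `a ≠ 0`), hence `coeff_k g = a · coeff_k h` is NOT a unit. Consequently, if `g` has a
unit coefficient in some degree `≤ k` ("`μ(g) = 0` and `λ(g) ≤ k`"), then NOT all coefficients of `g` below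
`k` vanish: `ord_T g < k`; and the same holds for any `L ∈ ℚ_p⟦T⟧` with `g = c · L` (`c ≠ 0` is not even needed)
(`theorem order_lt_of_X_add_C_dvd_of_isUnit_coeff`). With `k = 4` and the lower bound `3 ≤ ord_T L`
(Kato at `2` + corank `≥ 3` on the odd-parity half) this pins `ord_T L = 3` — exactly the item
`ParitySqueezeKernel` of the sketch (`theorem paritySqueezeKernel`, stated verbatim so that the future route
item closes by `exact Summit.BirchSwinnertonDyer.Rank2.paritySqueezeKernel`).

No named fact, no `sorry`; Mathlib only (`PowerSeries.order : ℕ∞`, `PadicInt`).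
-/

namespace Summit.BirchSwinnertonDyer.Rank2

open PowerSeries

section general

variable {R : Type*} [CommRing R] [IsDomain R]

/-- If `g = (X + C a) * h` with `a ≠ 0` in a domain and the coefficients of `g` in degrees `< k` vanish,
then so do the coefficients of `h` in degrees `< k`. -/
theorem coeff_eq_zero_of_X_add_C_mul {a : R} (ha0 : a ≠ 0) (h : PowerSeries R) (k : ℕ)
    (hg : ∀ j < k, coeff j ((X + C a) * h) = 0) : ∀ j < k, coeff j h = 0 := by
  intro j
  induction j with
  | zero =>
    intro hk
    have h0 := hg 0 hk
    have : coeff 0 ((X + C a) * h) = a * coeff 0 h := by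
      rw [add_mul, map_add, coeff_zero_X_mul, coeff_C_mul, zero_add]
    rw [this] at h0
    rcases mul_eq_zero.mp h0 with h1 | h1
    · exact absurd h1 ha0
    · exact h1
  | succ j ih =>
    intro hk
    have hj : coeff j h = 0 := ih (by omega)
    have h0 := hg (j + 1) hk
    have : coeff (j + 1) ((X + C a) * h) = coeff j h + a * coeff (j + 1) h := by
      rw [add_mul, map_add, coeff_succ_X_mul, coeff_C_mul]
    rw [this, hj, zero_add] at h0
    rcases mul_eq_zero.mp h0 with h1 | h1
    · exact absurd h1 ha0
    · exact h1

/-- If `(X + C a) ∣ g` with `a ≠ 0` a non-unit of a domain `R`, and the coefficients of `g` below `k`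
vanish, then NO coefficient of `g` in degree `≤ k` is a unit. -/
theorem not_isUnit_coeff_of_X_add_C_dvd {a : R} (ha0 : a ≠ 0) (ha : ¬ IsUnit a) {g : PowerSeries R}
    (hdvd : (X + C a) ∣ g) (k : ℕ) (hg : ∀ j < k, coeff j g = 0) :
    ∀ i ≤ k, ¬ IsUnit (coeff i g) := by
  obtain ⟨h, rfl⟩ := hdvd
  have hh := coeff_eq_zero_of_X_add_C_mul ha0 h k hg
  intro i hi
  rcases Nat.lt_or_ge i k with hlt | hge
  · rw [hg i hlt]; exact not_isUnit_zero
  · have hik : i = k := le_antisymm hi hge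
    subst hik
    -- `coeff i g = a * coeff i h`
    have key : coeff i ((X + C a) * h) = a * coeff i h := by
      cases i with
      | zero => rw [add_mul, map_add, coeff_zero_X_mul, coeff_C_mul, zero_add]
      | succ j =>
        rw [add_mul, map_add, coeff_succ_X_mul, coeff_C_mul, hh j (by omega), zero_add]
    rw [key]
    intro hu
    exact ha (isUnit_of_mul_isUnit_left hu)

end general

/-- **Order squeeze.** Let `g ∈ ℤ_p⟦X⟧` be an integral `ℚ_p`-multiple of `L ∈ ℚ_p⟦X⟧` (`g = c · L`;
`c ≠ 0` is not even needed), divisible by `X + C a` with `a ≠ 0` a non-unit of `ℤ_p`, and having a unit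
coefficient in some degree `≤ k`. Then `ord_X L < k`. -/
theorem order_lt_of_X_add_C_dvd_of_isUnit_coeff (p : ℕ) [Fact p.Prime] {a : ℤ_[p]} (ha0 : a ≠ 0)
    (ha : ¬ IsUnit a) (k : ℕ) (L : PowerSeries ℚ_[p]) (c : ℚ_[p]) (g : PowerSeries ℤ_[p])
    (hg : g.map (PadicInt.Coe.ringHom (p := p)) = C c * L) (hdvd : (X + C a) ∣ g)
    (hunit : ∃ i ≤ k, IsUnit (coeff i g)) : L.order < k := by
  by_contra hk
  replace hk := not_lt.mp hk
  -- all coefficients of `L`, hence of `g`, below `k` vanish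
  have hL : ∀ j < k, coeff j L = 0 := fun j hj ↦
    coeff_of_lt_order j (lt_of_lt_of_le (by exact_mod_cast hj) hk)
  have hgz : ∀ j < k, coeff j g = 0 := by
    intro j hj
    have h1 := congrArg (fun φ ↦ coeff j φ) hg
    simp only [coeff_map, PadicInt.Coe.ringHom_apply, coeff_C_mul, hL j hj, mul_zero] at h1
    exact PadicInt.coe_eq_zero.mp h1
  obtain ⟨i, hi, hu⟩ := hunit
  exact not_isUnit_coeff_of_X_add_C_dvd ha0 ha hdvd k hgz i hi hu

/-- `(p : ℤ_[p])` is non-zero. -/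
theorem natCast_p_ne_zero (p : ℕ) [hp : Fact p.Prime] : (p : ℤ_[p]) ≠ 0 := by
  exact_mod_cast hp.out.ne_zero

/-- `(p : ℤ_[p])` is not a unit. -/
theorem not_isUnit_natCast_p (p : ℕ) [Fact p.Prime] : ¬ IsUnit (p : ℤ_[p]) :=
  mem_nonunits_iff.mp PadicInt.p_nonunit

/-- The squeeze at the prime itself: `(X + C p) ∣ g`, `g = c · L` integral with a unit coefficient in
degree `≤ k`, and `k - 1 ≤ ord_X L` force `ord_X L = k - 1` (`1 ≤ k`). -/
theorem order_eq_of_X_add_C_p_dvd (p : ℕ) [Fact p.Prime] (k : ℕ) (hk : 1 ≤ k) (L : PowerSeries ℚ_[p])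
    (c : ℚ_[p]) (g : PowerSeries ℤ_[p])
    (hg : g.map (PadicInt.Coe.ringHom (p := p)) = C c * L) (hdvd : (X + C (p : ℤ_[p])) ∣ g)
    (hunit : ∃ i ≤ k, IsUnit (coeff i g)) (hord : ((k - 1 : ℕ) : ℕ∞) ≤ L.order) :
    L.order = (k - 1 : ℕ) := by
  have hlt := order_lt_of_X_add_C_dvd_of_isUnit_coeff p (natCast_p_ne_zero p) (not_isUnit_natCast_p p)
    k L c g hg hdvd hunit
  have hne : L.order ≠ ⊤ := ne_top_of_lt hlt
  obtain ⟨n, hn⟩ := ENat.ne_top_iff_exists.mp hne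
  rw [← hn] at hlt hord ⊢
  have h1 : n < k := by exact_mod_cast hlt
  have h2 : k - 1 ≤ n := by exact_mod_cast hord
  have : n = k - 1 := by omega
  rw [this]

/-- **`ParitySqueezeKernel`** of p2 GEN 13's door (F*) sketch, verbatim: if `c ≠ 0`, `g = c · L` is
integral, `(T + 2) ∣ g` in `ℤ₂⟦T⟧`, `g` has a unit coefficient in degree `≤ 4`, and `ord_T L ≥ 3`, then
`ord_T L = 3`. -/
theorem paritySqueezeKernel :
    ∀ (L : PowerSeries ℚ_[2]) (c : ℚ_[2]) (g : PowerSeries ℤ_[2]), c ≠ 0 →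
      g.map (PadicInt.Coe.ringHom (p := 2)) = PowerSeries.C c * L →
      (PowerSeries.X + PowerSeries.C (2 : ℤ_[2])) ∣ g →
      (∃ i ≤ 4, IsUnit (PowerSeries.coeff i g)) → 3 ≤ L.order → L.order = 3 := by
  intro L c g _ hg hdvd hunit hord
  have h2 : ((2 : ℕ) : ℤ_[2]) = (2 : ℤ_[2]) := by norm_num
  have hdvd' : (X + C ((2 : ℕ) : ℤ_[2])) ∣ g := by rw [h2]; exact hdvd
  have hord' : ((4 - 1 : ℕ) : ℕ∞) ≤ L.order := by norm_num; exact hord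
  have := order_eq_of_X_add_C_p_dvd 2 4 (by norm_num) L c g hg hdvd' hunit hord'
  rw [this]; norm_num

/-- The general-`k` form at `p = 2` (for door variants with a different bad-prime cost `c(E)`):
`(T + 2) ∣ g`, unit coefficient in degree `≤ k`, `k - 1 ≤ ord_T L` ⟹ `ord_T L = k - 1`
(no hypothesis on `c`). -/
theorem paritySqueezeKernel_general (k : ℕ) (hk : 1 ≤ k) (L : PowerSeries ℚ_[2]) (c : ℚ_[2])
    (g : PowerSeries ℤ_[2])
    (hg : g.map (PadicInt.Coe.ringHom (p := 2)) = PowerSeries.C c * L)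
    (hdvd : (PowerSeries.X + PowerSeries.C (2 : ℤ_[2])) ∣ g)
    (hunit : ∃ i ≤ k, IsUnit (PowerSeries.coeff i g)) (hord : ((k - 1 : ℕ) : ℕ∞) ≤ L.order) :
    L.order = (k - 1 : ℕ) := by
  have h2 : ((2 : ℕ) : ℤ_[2]) = (2 : ℤ_[2]) := by norm_num
  have hdvd' : (X + C ((2 : ℕ) : ℤ_[2])) ∣ g := by rw [h2]; exact hdvd
  exact order_eq_of_X_add_C_p_dvd 2 k hk L c g hg hdvd' hunit hord

end Summit.BirchSwinnertonDyer.Rank2
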